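import Literature.NumberTheory.LFunctions.RodgersTaoEnergy
import Literature.NumberTheory.LFunctions.RodgersTaoProofs
import Literature.NumberTheory.LFunctions.DobnerLemma4Proofs
import Mathlib.Analysis.Real.Pi.Bounds
import Mathlib.Analysis.SpecialFunctions.Pow.Asymptotics
import Mathlib.MeasureTheory.Integral.Average
import HarnessLib

/-!
# Rodgers–Tao 2020, §§8–9: from Thm. 7.2 and Prop. 8.2 to Prop. 8.1, (picketfence) and `Λ ≥ 0`

Trunk T-ANT (`Literature/NumberTheory/LFunctions`). Proofs only. Companion of
`RodgersTaoEnergy.lean` (definitions `Ψ`, `ξ_j`, `x_j(t)`, `V`, `Ẽ` and the named facts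
`Literature.NumberTheory.LFunctions.rodgers_tao_energy_bound_zero` = Prop. 8.1, `Literature.NumberTheory.LFunctions.rodgers_tao_zeros_zero` =
"`x_{n+1}(0) = 2γ_n`, distinct") and of `RodgersTao.lean` / `RodgersTaoProofs.lean` (the cut of
the printed proof at display (picketfence) of §9 and the assembly of Thm. 1.1 from it). Here the
cut is moved up to Prop. 8.1: we prove the first half of §9 of B. Rodgers, T. Tao, *The de
Bruijn–Newman constant is non-negative*, Forum Math. Pi 8 (2020) (arXiv:1801.05914 numbering),

* `Literature.NumberTheory.LFunctions.rodgers_tao_picket_fence_of_energy_bound` — Prop. 8.1 and the identification of the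
  zeros at time zero imply the picket-fence estimate `Literature.NumberTheory.LFunctions.rodgers_tao_picket_fence`;
* `Literature.NumberTheory.LFunctions.rodgers_tao_energy_bound_zero_of_propagation` — Thm. 7.2
  (`Literature.NumberTheory.LFunctions.rodgers_tao_integrated_energy_bound`), Prop. 8.2
  (`Literature.NumberTheory.LFunctions.rodgers_tao_energy_propagation`) and the identification of the zeros at time zero
  imply Prop. 8.1 (`Literature.NumberTheory.LFunctions.rodgers_tao_energy_bound_zero`): the half page of §8 following the
  statement of Prop. 8.2 (pigeonholing a good starting time, `O(log² T)` applications of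
  Prop. 8.2, monotonicity of `Ẽ^I(0)` in `I`);

together with the window form of Lemma 3.1 that it uses,

* `Literature.NumberTheory.LFunctions.classicalLocation_gap_window` — for `T ≥ 4π`, `log T > log 4π`, `T log T ≤ j`,
  `j + 1 ≤ 4T log T`: `0 < ξ_{j+1} − ξ_j ≤ 4π/(log T − log 4π)` and
  `|(ξ_{j+1} − ξ_j) log T/(4π) − 1| ≤ log(4π)/(log T − log 4π)` (so `ξ_{j+1} − ξ_j =
  (4π + o(1))/log T` uniformly in the window, as used in §9; from `Ψ(ξ_{j+1}) − Ψ(ξ_j) = 1`, the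
  mean value theorem and `T ≤ ξ_j ≤ 16πT`);

and finally the discharges (ex falso, from `Λ ≥ 0`) of the `Λ < 0`-conditional named facts of
`RodgersTaoEnergy.lean` (last section).

The resulting assembly of Theorem 1.1 from named inputs — `rodgers_tao_integrated_energy_bound`
(Thm. 7.2, i.e. §§2–7 of the source), `rodgers_tao_energy_propagation` (Prop. 8.2, Bourgain's
propagation argument of §8), `rodgers_tao_zeros_zero` (§1.2: RH and simplicity under `Λ < 0`),
`riemann_von_mangoldt` (Titchmarsh Thm. 9.4) and `selberg_fujii_small_gaps` (Titchmarsh (9.25.6))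
imply `Literature.NumberTheory.LFunctions.rodgers_tao : ∀ t < 0, ¬ HasOnlyRealZeros (deBruijnH t)`
— is the three-step composite `rodgers_tao_of_picket_fence
(rodgers_tao_picket_fence_of_energy_bound (rodgers_tao_energy_bound_zero_of_propagation h72 h82 hz)
hz) h h₂` of Prop. 8.1
(`rodgers_tao_energy_bound_zero_of_propagation`, here), (picketfence)
(`rodgers_tao_picket_fence_of_energy_bound`, here) and `rodgers_tao_of_picket_fence`
(`RodgersTaoProofs.lean`). It is not kept as a separate declaration (formerly
`rodgers_tao_of_integrated_energy_bound`, and, from Prop. 8.1 alone, `rodgers_tao_of_energy_bound`;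
removed on 2026-08-15, gate alias probe): its conclusion is the tree theorem
`Literature.NumberTheory.LFunctions.rodgers_tao_holds` (`Λ ≥ 0`, `DobnerLemma4Proofs.lean`, proved
along Dobner's independent route), of which any such conditional assembly is a restatement. The
composable reductions it chained are unchanged.

## The argument (§9 of the source, first half)

Fix `ε`; put `e = min(ε, 1)`, `δ = (e/3)²`, `ε₁ = δe/(128π²)`. For large `T` let `L = log T`,
`W = [⌈TL⌉, ⌊2TL⌋]`, `W' = {n ∈ W | n + 2 ≤ ⌊2TL⌋}`. By `rodgers_tao_zeros_zero` the energies
`Ẽ_{jk}(0)`, `j ≠ k ∈ W`, are non-negative, so the nearest-neighbour terms give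
`Σ_{n ∈ W'} Ẽ_{n+1,n+2}(0) ≤ Ẽ^W(0) ≤ ε₁ T L³` (Prop. 8.1). With `d_n = ξ_{n+2} − ξ_{n+1} ≤ 8π/L`
(window lemma) this gives `Σ_{n ∈ W'} V(g_n) ≤ 64π² ε₁ T L = δ e T L/2`, where
`g_n = 2(γ_{n+1} − γ_n)/d_n > 0` and `Ẽ_{n+1,n+2}(0) = V(g_n)/d_n²`. By Markov at most `eTL/2`
indices `n ∈ W'` have `V(g_n) ≥ δ`; for the others `(g_n − 1)² ≤ V(g_n) < δ`, i.e.
`|g_n − 1| < e/3`, and `|d_n L/(4π) − 1| ≤ log(4π)/(L − log 4π) ≤ e/3`, whence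
`|(γ_{n+1} − γ_n) L/(2π) − 1| = |g_n · d_n L/(4π) − 1| ≤ e ≤ ε`. The at most two indices of
`W ∖ W'` are absorbed by `eTL ≥ 4`.

## The argument (§8 of the source: Prop. 8.1 from Thm. 7.2 and Prop. 8.2)

Fix `ε` and the witness `t₀ < 0`. Thm. 7.2 at level `ε|t₀|/8` and the first moment method give
`t_* ∈ (t₀/4, 0]` with `Ẽ^{[½TL, 3TL]}(t_*) ≤ (ε/2) T L³`. With `K = ⌈|t_*| · 100L²⌉ ≤ 25|t₀|L² + 1`
steps of length `|t_*|/K ≤ 1/(100L²)` Prop. 8.2 gives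
`Ẽ^{[½TL + KL³, 3TL − KL³]}(0) ≤ (ε/2) T L³ + K C' L^A` (`C' = max(C,0)`), and
`[TL, 2TL] ⊆ [½TL + KL³, 3TL − KL³]` as soon as `KL³ ≤ ½TL` (i.e. `O(L⁵) ≤ ½TL`); since the
energies at time `0` are non-negative, `Ẽ^{[TL,2TL]}(0) ≤ (ε/2)TL³ + (25|t₀|+1) C' L^{A+2} ≤ ε T L³`
for large `T`.

## References

* B. Rodgers, T. Tao, *The de Bruijn–Newman constant is non-negative*, Forum Math. Pi 8 (2020),
  e6; arXiv:1801.05914: Lemma 3.1, §7 (Thm. 7.2), §8 (Prop. 8.1, Prop. 8.2 and the deduction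
  between them), §9.
* E. C. Titchmarsh, *The Theory of the Riemann Zeta-Function*, 2nd ed. (1986), Thm. 9.4,
  §9.25.
-/

noncomputable section

open Real Filter Set

namespace Literature.NumberTheory.LFunctions

/-! ## Lemma 3.1 in the window `[T log T, 2T log T]`: the spacing of the classical locations -/

/-- `1 ≤ 4π`. [folklore] -/
theorem one_le_four_pi : (1 : ℝ) ≤ 4 * π := by linarith [Real.pi_gt_three]

/-- `1 < log 4`. [folklore] -/
theorem one_lt_log_four : (1 : ℝ) < Real.log 4 := by
  rw [Real.lt_log_iff_exp_lt (by norm_num)]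
  linarith [Real.exp_one_lt_three]

/-- `Ψ(T) ≤ T log T` for `T ≥ 4π`. [folklore] -/
theorem rodgersTaoPsi_le_mul_log {T : ℝ} (hT : 4 * π ≤ T) :
    rodgersTaoPsi T ≤ T * Real.log T := by
  have hπ : 0 < 4 * π := by positivity
  have hT0 : 0 < T := hπ.trans_le hT
  have hlog : Real.log (T / (4 * π)) ≤ Real.log T :=
    Real.log_le_log (div_pos hT0 hπ) (div_le_self hT0.le one_le_four_pi)
  have hlog0 : 0 ≤ Real.log T := Real.log_nonneg (one_le_four_pi.trans hT)
  have h1 : T / (4 * π) * Real.log (T / (4 * π)) ≤ T / (4 * π) * Real.log T :=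
    mul_le_mul_of_nonneg_left hlog (by positivity)
  have h2 : T / (4 * π) * Real.log T ≤ T * Real.log T :=
    mul_le_mul_of_nonneg_right (div_le_self hT0.le one_le_four_pi) hlog0
  have h3 : 0 ≤ T / (4 * π) := by positivity
  rw [rodgersTaoPsi]
  linarith

/-- `Ψ(16πT) = 4T log(4T) − 4T`. [folklore] -/
theorem rodgersTaoPsi_sixteen_pi_mul (T : ℝ) :
    rodgersTaoPsi (16 * π * T) = 4 * T * Real.log (4 * T) - 4 * T := by
  have h : 16 * π * T / (4 * π) = 4 * T := by
    field_simp
    ring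
  rw [rodgersTaoPsi, h]

/-- `4 T log T ≤ Ψ(16πT)` for `T ≥ 1` (since `log 4 > 1`). [folklore] -/
theorem four_mul_mul_log_le_rodgersTaoPsi {T : ℝ} (hT : 1 ≤ T) :
    4 * T * Real.log T ≤ rodgersTaoPsi (16 * π * T) := by
  rw [rodgersTaoPsi_sixteen_pi_mul, Real.log_mul (by norm_num) (by linarith)]
  nlinarith [one_lt_log_four]

/-- Lower window bound: for `T ≥ 4π` and `T log T ≤ j`, `T ≤ ξ_j` (cf. Lemma 3.1 (i):
`ξ_j ≍ j / log j`). [cite: RodgersTaoFMP2020, Lemma 3.1 (i)] -/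
theorem self_le_classicalLocation {T j : ℝ} (hT : 4 * π ≤ T) (hj : T * Real.log T ≤ j) :
    T ≤ classicalLocation j := by
  have hlog0 : 0 ≤ Real.log T := Real.log_nonneg (one_le_four_pi.trans hT)
  have hT0 : 0 ≤ T := le_trans (by positivity) hT
  have hj1 : -1 ≤ j := le_trans (by linarith [mul_nonneg hT0 hlog0]) hj
  rw [le_classicalLocation_iff_rodgersTaoPsi_le hj1 hT]
  exact (rodgersTaoPsi_le_mul_log hT).trans hj

/-- Upper window bound: for `T ≥ 1` and `−1 ≤ j ≤ 4 T log T`, `ξ_j ≤ 16πT`.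
[cite: RodgersTaoFMP2020, Lemma 3.1 (i)] -/
theorem classicalLocation_le_sixteen_pi_mul {T j : ℝ} (hT : 1 ≤ T) (hj1 : -1 ≤ j)
    (hj : j ≤ 4 * T * Real.log T) : classicalLocation j ≤ 16 * π * T := by
  have h16 : 4 * π ≤ 16 * π * T := by nlinarith [Real.pi_pos]
  rw [classicalLocation_le_iff_le_rodgersTaoPsi hj1 h16]
  exact hj.trans (four_mul_mul_log_le_rodgersTaoPsi hT)

/-- Mean value theorem for `Ψ` between consecutive classical locations: for `j ≥ −1` there is
`θ ∈ (ξ_j, ξ_{j+1})` with `(ξ_{j+1} − ξ_j) · log(θ/4π)/(4π) = Ψ(ξ_{j+1}) − Ψ(ξ_j) = 1` (the proof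
of Lemma 3.1 (ii)–(iii) in the source). [cite: RodgersTaoFMP2020, Lemma 3.1 (proof)] -/
theorem exists_classicalLocation_gap_mul_eq_one {j : ℝ} (hj : -1 ≤ j) :
    ∃ θ : ℝ, classicalLocation j < θ ∧ θ < classicalLocation (j + 1) ∧
      (classicalLocation (j + 1) - classicalLocation j) *
        (Real.log (θ / (4 * π)) / (4 * π)) = 1 := by
  have hj' : -1 ≤ j + 1 := by linarith
  have hlt : classicalLocation j < classicalLocation (j + 1) :=
    strictMonoOn_classicalLocation hj hj' (by linarith)
  have h4 := four_pi_le_classicalLocation hj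
  have hπ : 0 < 4 * π := by positivity
  obtain ⟨θ, hθ, hθ'⟩ := exists_hasDerivAt_eq_slope rodgersTaoPsi
    (fun θ ↦ Real.log (θ / (4 * π)) / (4 * π)) hlt continuous_rodgersTaoPsi.continuousOn
    (fun θ hθ ↦ hasDerivAt_rodgersTaoPsi (hπ.trans_le (h4.trans hθ.1.le)).ne')
  refine ⟨θ, hθ.1, hθ.2, ?_⟩
  have hne : classicalLocation (j + 1) - classicalLocation j ≠ 0 := sub_ne_zero.2 hlt.ne'
  rw [hθ', rodgersTaoPsi_classicalLocation hj, rodgersTaoPsi_classicalLocation hj']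
  field_simp
  ring

/-- **Lemma 3.1 (iii) in the window** (explicit form of `ξ_{j+1} − ξ_j = (4π + o(1))/log T` for
`j ∈ [T log T, 2T log T]`, used in §9). Let `T ≥ 4π` with `log(4π) < log T`, and let
`T log T ≤ j`, `j + 1 ≤ 4 T log T`. Then `0 < ξ_{j+1} − ξ_j ≤ 4π/(log T − log 4π)` and
`|(ξ_{j+1} − ξ_j) log T/(4π) − 1| ≤ log(4π)/(log T − log 4π)`.
[cite: RodgersTaoFMP2020, Lemma 3.1 (iii) and §9] -/
theorem classicalLocation_gap_window {T j : ℝ} (hT : 4 * π ≤ T)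
    (hL : Real.log (4 * π) < Real.log T) (hj : T * Real.log T ≤ j)
    (hj' : j + 1 ≤ 4 * T * Real.log T) :
    0 < classicalLocation (j + 1) - classicalLocation j ∧
      classicalLocation (j + 1) - classicalLocation j ≤ 4 * π / (Real.log T - Real.log (4 * π)) ∧
      |(classicalLocation (j + 1) - classicalLocation j) * Real.log T / (4 * π) - 1| ≤
        Real.log (4 * π) / (Real.log T - Real.log (4 * π)) := by
  have hπ : 0 < 4 * π := by positivity
  have hT1 : 1 ≤ T := one_le_four_pi.trans hT
  have hT0 : 0 < T := by linarith
  have hlog0 : 0 ≤ Real.log T := Real.log_nonneg hT1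
  have hj1 : -1 ≤ j := le_trans (by linarith [mul_nonneg hT0.le hlog0]) hj
  have hj1' : -1 ≤ j + 1 := by linarith
  obtain ⟨θ, hθ1, hθ2, hθ⟩ := exists_classicalLocation_gap_mul_eq_one hj1
  -- location of `θ`: `T ≤ ξ_j < θ < ξ_{j+1} ≤ 16πT`
  have hθT : T < θ := (self_le_classicalLocation hT hj).trans_lt hθ1
  have hθT' : θ < 16 * π * T :=
    hθ2.trans_le (classicalLocation_le_sixteen_pi_mul hT1 hj1' (by linarith))
  have hθ0 : 0 < θ := hT0.trans hθT
  -- hence `log T − log 4π ≤ log(θ/4π) ≤ log T + log 4`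
  set ℓ : ℝ := Real.log (θ / (4 * π)) with hℓ
  have hℓ_eq : ℓ = Real.log θ - Real.log (4 * π) := Real.log_div hθ0.ne' hπ.ne'
  have hℓ_lo : Real.log T - Real.log (4 * π) ≤ ℓ := by
    rw [hℓ_eq]
    linarith [Real.log_le_log hT0 hθT.le]
  have hℓ_hi : ℓ ≤ Real.log T + Real.log 4 := by
    rw [hℓ_eq]
    have h1 : Real.log θ ≤ Real.log (16 * π * T) := Real.log_le_log hθ0 hθT'.le
    have h2 : Real.log (16 * π * T) = Real.log 4 + Real.log (4 * π) + Real.log T := by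
      rw [show (16 : ℝ) * π * T = 4 * (4 * π) * T by ring, Real.log_mul (by positivity) hT0.ne',
        Real.log_mul (by norm_num) hπ.ne']
    linarith
  have hden : 0 < Real.log T - Real.log (4 * π) := by linarith
  have hℓ0 : 0 < ℓ := hden.trans_le hℓ_lo
  -- the gap is `4π/ℓ`
  set d : ℝ := classicalLocation (j + 1) - classicalLocation j with hd
  have hd_eq : d = 4 * π / ℓ := by
    have : d * (ℓ / (4 * π)) = 1 := hθ
    field_simp at this ⊢
    linarith
  have hd0 : 0 < d := by rw [hd_eq]; positivity
  refine ⟨hd0, ?_, ?_⟩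
  · rw [hd_eq]
    exact div_le_div_of_nonneg_left hπ.le hden hℓ_lo
  · -- `d log T/(4π) − 1 = (log T − ℓ)/ℓ`, and `|log T − ℓ| ≤ log 4π`
    have hlog4 : Real.log 4 ≤ Real.log (4 * π) :=
      Real.log_le_log (by norm_num) (by linarith [Real.pi_gt_three])
    have hkey : d * Real.log T / (4 * π) - 1 = (Real.log T - ℓ) / ℓ := by
      rw [hd_eq]
      field_simp
    rw [hkey, abs_div, abs_of_pos hℓ0, div_le_div_iff₀ hℓ0 hden]
    have habs : |Real.log T - ℓ| ≤ Real.log (4 * π) := by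
      rw [abs_le]
      constructor <;> linarith
    calc |Real.log T - ℓ| * (Real.log T - Real.log (4 * π))
        ≤ Real.log (4 * π) * (Real.log T - Real.log (4 * π)) :=
          mul_le_mul_of_nonneg_right habs hden.le
      _ ≤ Real.log (4 * π) * ℓ :=
          mul_le_mul_of_nonneg_left hℓ_lo (Real.log_nonneg (one_le_four_pi))

end Literature.NumberTheory.LFunctions

end

noncomputable section

open Real Filter Set

namespace Literature.NumberTheory.LFunctions

/-! ## §9: from the energy bound at time zero (Prop. 8.1) to (picketfence) -/

/-- Non-negativity of the renormalised energies at time zero under the identification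
`x_{n+1}(0) = 2γ_n` with distinct `γ_n`: for distinct positive indices `j ≠ k` the argument of `V`
in `Ẽ_{jk}(0)` is non-zero, so `Ẽ_{jk}(0) ≥ 0`. [cite: RodgersTaoFMP2020, §7] -/
theorem renormEnergy_zero_nonneg (hx : ∀ n : ℕ, deBruijnZero 0 (n + 1) = 2 * zetaOrdinate n)
    (hγ : StrictMono zetaOrdinate) {j k : ℕ} (hj : 1 ≤ j) (hk : 1 ≤ k) (hjk : j ≠ k) :
    0 ≤ renormEnergy 0 j k := by
  obtain ⟨m₁, rfl⟩ : ∃ m, j = m + 1 := ⟨j - 1, by omega⟩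
  obtain ⟨m₂, rfl⟩ : ∃ m, k = m + 1 := ⟨k - 1, by omega⟩
  rw [renormEnergy_eq, hx, hx]
  refine div_nonneg (renormPotential_nonneg (div_ne_zero ?_ ?_)) (sq_nonneg _)
  · have hne : m₂ ≠ m₁ := fun h ↦ hjk (by rw [h])
    intro h0
    exact hne (hγ.injective (by linarith))
  · refine sub_ne_zero.2 fun h ↦ hjk ?_
    have h1 : ((m₂ + 1 : ℕ) : ℝ) ∈ Ici (-1 : ℝ) := by
      simp only [mem_Ici]; exact le_trans (by norm_num) (Nat.cast_nonneg _)
    have h2 : ((m₁ + 1 : ℕ) : ℝ) ∈ Ici (-1 : ℝ) := by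
      simp only [mem_Ici]; exact le_trans (by norm_num) (Nat.cast_nonneg _)
    exact_mod_cast (strictMonoOn_classicalLocation.injOn h1 h2 h).symm

/-- The nearest-neighbour part of the energy: if every `n ∈ W'` has `n + 1, n + 2 ∈ W` and the
energies on `W` are non-negative, then `Σ_{n ∈ W'} Ẽ_{n+1,n+2}(t) ≤ Ẽ^W(t)` (first display of
§9). [cite: RodgersTaoFMP2020, §9] -/
theorem sum_renormEnergy_succ_le {t : ℝ} {W W' : Finset ℕ}
    (hnonneg : ∀ p ∈ W.offDiag, 0 ≤ renormEnergy t p.1 p.2)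
    (hW' : ∀ n ∈ W', n + 1 ∈ W ∧ n + 2 ∈ W) :
    ∑ n ∈ W', renormEnergy t (n + 1) (n + 2) ≤ renormEnergyOn t W := by
  classical
  have hinj : Set.InjOn (fun n : ℕ ↦ (n + 1, n + 2)) W' := fun n _ m _ h ↦ by
    simpa using congrArg Prod.fst h
  have hsum : ∑ n ∈ W', renormEnergy t (n + 1) (n + 2) =
      ∑ p ∈ W'.image fun n : ℕ ↦ (n + 1, n + 2), renormEnergy t p.1 p.2 := by
    rw [Finset.sum_image hinj]
  rw [hsum, renormEnergyOn_eq]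
  refine Finset.sum_le_sum_of_subset_of_nonneg ?_ fun p hp _ ↦ hnonneg p hp
  intro p hp
  obtain ⟨n, hn, rfl⟩ := Finset.mem_image.1 hp
  exact Finset.mem_offDiag.2 ⟨(hW' n hn).1, (hW' n hn).2, by simp⟩

/-- Markov's inequality on a finite set: `δ · #{n ∈ s | δ ≤ f n} ≤ Σ_{n ∈ s} f n` for `f ≥ 0` on
`s`. [folklore] -/
theorem mul_card_filter_le_sum {s : Finset ℕ} {f : ℕ → ℝ} {δ : ℝ}
    (hf : ∀ n ∈ s, 0 ≤ f n) :
    δ * ((s.filter fun n ↦ δ ≤ f n).card : ℝ) ≤ ∑ n ∈ s, f n := by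
  classical
  calc δ * ((s.filter fun n ↦ δ ≤ f n).card : ℝ)
      = ∑ n ∈ s.filter (fun n ↦ δ ≤ f n), δ := by simp [mul_comm]
    _ ≤ ∑ n ∈ s.filter (fun n ↦ δ ≤ f n), f n :=
        Finset.sum_le_sum fun n hn ↦ (Finset.mem_filter.1 hn).2
    _ ≤ ∑ n ∈ s, f n :=
        Finset.sum_le_sum_of_subset_of_nonneg (Finset.filter_subset _ _) fun n hn _ ↦ hf n hn

/-- Energy of a consecutive pair at time zero in terms of the ordinates:
`Ẽ_{n+1,n+2}(0) = V(2(γ_{n+1} − γ_n)/(ξ_{n+2} − ξ_{n+1})) / (ξ_{n+2} − ξ_{n+1})²` under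
`x_{m+1}(0) = 2γ_m`. [cite: RodgersTaoFMP2020, §9] -/
theorem renormEnergy_succ_succ_eq (hx : ∀ n : ℕ, deBruijnZero 0 (n + 1) = 2 * zetaOrdinate n)
    (n : ℕ) :
    renormEnergy 0 (n + 1) (n + 2) =
      renormPotential ((2 * zetaOrdinate (n + 1) - 2 * zetaOrdinate n) /
          (classicalLocation ((n : ℝ) + 2) - classicalLocation ((n : ℝ) + 1))) /
        (classicalLocation ((n : ℝ) + 2) - classicalLocation ((n : ℝ) + 1)) ^ 2 := by
  rw [renormEnergy_eq, hx, hx]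
  push_cast
  rfl

/-- Algebra of Step A of §9: if `0 < d`, `0 < L`, `d L ≤ 8π` and `0 ≤ v` then
`v ≤ (64π²/L²) · (v/d²)`. [folklore] -/
theorem le_mul_div_sq_of_mul_le {v d L : ℝ} (hd : 0 < d) (hL : 0 < L) (hdL : d * L ≤ 8 * π)
    (hv : 0 ≤ v) : v ≤ 64 * π ^ 2 / L ^ 2 * (v / d ^ 2) := by
  have h1 : (d * L) ^ 2 ≤ (8 * π) ^ 2 := pow_le_pow_left₀ (by positivity) hdL 2
  have h2 : d ^ 2 * L ^ 2 ≤ 64 * π ^ 2 := by nlinarith [h1]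
  have h3 : 64 * π ^ 2 / L ^ 2 * (v / d ^ 2) = v * (64 * π ^ 2 / (d ^ 2 * L ^ 2)) := by
    field_simp
  rw [h3]
  have h4 : 1 ≤ 64 * π ^ 2 / (d ^ 2 * L ^ 2) := by
    rw [le_div_iff₀ (by positivity)]
    linarith
  nlinarith

/-- Per-element estimate (§9, reading the displays after (picketfence) backwards). If `0 < d`,
`γ₀ < γ₁`, `|d L/(4π) − 1| ≤ τ ≤ min(e/3, 1)` and `V((2γ₁ − 2γ₀)/d) < (e/3)² ≤ 1`, then
`|(γ₁ − γ₀) L/(2π) − 1| ≤ e`. [cite: RodgersTaoFMP2020, §9] -/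
theorem abs_gap_sub_one_le_of_renormPotential_lt {γ₀ γ₁ d L e τ : ℝ} (hd : 0 < d)
    (hγ : γ₀ < γ₁) (hρ : |d * L / (4 * π) - 1| ≤ τ) (hτe : τ ≤ e / 3) (hτ1 : τ ≤ 1)
    (he3 : (e / 3) ^ 2 ≤ 1) (he : 0 < e)
    (hV : renormPotential ((2 * γ₁ - 2 * γ₀) / d) < (e / 3) ^ 2) :
    |(γ₁ - γ₀) * L / (2 * π) - 1| ≤ e := by
  have hg0 : 0 < (2 * γ₁ - 2 * γ₀) / d := div_pos (by linarith) hd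
  have hsq := sq_sub_one_lt_of_renormPotential_lt hg0.ne' he3 hV
  rw [abs_of_pos hg0] at hsq
  have hg1 : |(2 * γ₁ - 2 * γ₀) / d - 1| < e / 3 := abs_lt_of_sq_lt_sq hsq (by positivity)
  have hprod : (γ₁ - γ₀) * L / (2 * π) = (2 * γ₁ - 2 * γ₀) / d * (d * L / (4 * π)) := by
    field_simp
    ring
  rw [hprod]
  exact abs_mul_sub_one_le hg1.le hρ le_rfl hτe hτ1

/-- At most two indices of `[a, b]` fail to have `n + 2 ≤ b`. [folklore] -/
theorem card_filter_not_add_two_le (a b : ℕ) :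
    ((Finset.Icc a b).filter fun n ↦ ¬ n + 2 ≤ b).card ≤ 2 := by
  calc ((Finset.Icc a b).filter fun n ↦ ¬ n + 2 ≤ b).card ≤ (Finset.Icc (b - 1) b).card := by
        refine Finset.card_le_card fun n hn ↦ ?_
        simp only [Finset.mem_filter, Finset.mem_Icc] at hn ⊢
        omega
    _ ≤ 2 := by rw [Nat.card_Icc]; omega

/-- The thresholds of the §9 argument: numerical consequences of
`log 4π + 3 log(4π)/e ≤ log T` and `4/e ≤ T log T` for `0 < e ≤ 1`. [folklore] -/
theorem picket_fence_thresholds {e T : ℝ} (he0 : 0 < e) (he1 : e ≤ 1)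
    (hΛ₀ : Real.log (4 * π) + 3 * Real.log (4 * π) / e ≤ Real.log T)
    (hTe : 4 / e ≤ T * Real.log T) :
    Real.log (4 * π) < Real.log T ∧ 0 < Real.log T ∧
      Real.log (4 * π) / (Real.log T - Real.log (4 * π)) ≤ e / 3 ∧
      Real.log (4 * π) / (Real.log T - Real.log (4 * π)) ≤ 1 ∧
      (∀ d : ℝ, d ≤ 4 * π / (Real.log T - Real.log (4 * π)) → d * Real.log T ≤ 8 * π) ∧
      4 ≤ e * (T * Real.log T) ∧ 1 ≤ T * Real.log T := by
  have hlog4π : 0 < Real.log (4 * π) :=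
    Real.log_pos (by linarith [one_le_four_pi, Real.pi_gt_three])
  set L := Real.log T with hL
  set c := Real.log (4 * π) with hc
  have h3 : 3 * c ≤ 3 * c / e := by
    rw [le_div_iff₀ he0]; nlinarith
  have hLgt : c < L := by
    have : 0 < 3 * c / e := by positivity
    linarith
  have hden : 0 < L - c := by linarith
  have hτe : c / (L - c) ≤ e / 3 := by
    rw [div_le_iff₀ hden]
    have h1 : 3 * c / e ≤ L - c := by linarith
    rw [div_le_iff₀' he0] at h1
    linarith
  have hTL4 : 4 ≤ e * (T * L) := by rwa [div_le_iff₀' he0] at hTe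
  refine ⟨hLgt, hlog4π.trans hLgt, hτe, by linarith, fun d hd ↦ ?_, hTL4, by nlinarith⟩
  have hL2 : 2 * c ≤ L := by linarith
  have h1 : d * L ≤ 4 * π / (L - c) * L := mul_le_mul_of_nonneg_right hd (by linarith)
  have h2 : 4 * π / (L - c) * L ≤ 8 * π := by
    rw [div_mul_eq_mul_div, div_le_iff₀ hden]
    nlinarith [Real.pi_pos]
  linarith

/-- **Rodgers–Tao 2020, §9: Prop. 8.1 implies the picket-fence estimate.** Under `Λ < 0`, the
energy bound at time zero `Ẽ^{[T log T, 2T log T]}(0) = o(T log³ T)`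
(`rodgers_tao_energy_bound_zero`, Prop. 8.1) and the identification `x_{n+1}(0) = 2γ_n` with
distinct `γ_n` (`rodgers_tao_zeros_zero`) give (picketfence): for every `ε > 0` and all large
`T`, all but `ε T log T` of the `n ∈ [T log T, 2T log T]` have `|(γ_{n+1} − γ_n) log T/(2π) − 1|
≤ ε`. The proof is that of the source: the nearest-neighbour terms of `Ẽ` are bounded by the
whole (non-negative) sum, `ξ_{j+1} − ξ_j = (4π + o(1))/log T` in the window
(`Literature.NumberTheory.LFunctions.classicalLocation_gap_window`), Markov's inequality, and `V(x) = o(1) ⇒ x = 1 + o(1)`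
(`Literature.NumberTheory.LFunctions.sq_sub_one_lt_of_renormPotential_lt`). [cite: RodgersTaoFMP2020, §9] -/
theorem rodgers_tao_picket_fence_of_energy_bound (h81 : rodgers_tao_energy_bound_zero)
    (hz : rodgers_tao_zeros_zero) : rodgers_tao_picket_fence := by
  intro hΛ ε hε
  classical
  obtain ⟨hx, hγ⟩ := hz hΛ
  -- parameters: `e = min ε 1`, `δ = (e/3)²`, `ε₁ = δ e/(128π²)`
  obtain ⟨e, he0, heε, he1⟩ : ∃ e : ℝ, 0 < e ∧ e ≤ ε ∧ e ≤ 1 :=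
    ⟨min ε 1, lt_min hε one_pos, min_le_left _ _, min_le_right _ _⟩
  have he3 : (e / 3) ^ 2 ≤ 1 := by nlinarith
  have hδ0 : 0 < (e / 3) ^ 2 := by positivity
  have hε₁0 : 0 < (e / 3) ^ 2 * e / (128 * π ^ 2) := by positivity
  obtain ⟨T₁, hT₁⟩ := h81 hΛ _ hε₁0
  -- thresholds in `T`
  have hev : ∀ᶠ T : ℝ in atTop, T₁ ≤ T ∧ 4 * π ≤ T ∧
      Real.log (4 * π) + 3 * Real.log (4 * π) / e ≤ Real.log T ∧ 4 / e ≤ T * Real.log T := by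
    refine (eventually_ge_atTop T₁).and ((eventually_ge_atTop _).and
      ((Real.tendsto_log_atTop.eventually_ge_atTop _).and ?_))
    exact (tendsto_id.atTop_mul_atTop₀ Real.tendsto_log_atTop).eventually_ge_atTop _
  obtain ⟨T₀, hT₀⟩ := eventually_atTop.1 hev
  refine ⟨T₀, fun T hT ↦ ?_⟩
  obtain ⟨hTT₁, hT4π, hTΛ₀, hTe⟩ := hT₀ T hT
  obtain ⟨hLgt, hLpos, hτe, hτ1, hdL, hTL4, hTL1⟩ := picket_fence_thresholds he0 he1 hTΛ₀ hTe
  set L : ℝ := Real.log T with hL_def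
  have hT0 : 0 < T := lt_of_lt_of_le (by positivity) hT4π
  have hTLpos : 0 < T * L := by linarith
  -- the window `W = [a, b]`
  set a : ℕ := ⌈T * L⌉₊ with ha_def
  set b : ℕ := ⌊2 * T * L⌋₊ with hb_def
  set W : Finset ℕ := Finset.Icc a b with hW_def
  have haTL : T * L ≤ a := Nat.le_ceil _
  have ha1 : 1 ≤ a := Nat.one_le_ceil_iff.2 hTLpos
  have hb2TL : (b : ℝ) ≤ 2 * T * L := Nat.floor_le (by positivity)
  -- non-negativity on `W.offDiag` and the energy bound at this `T`
  have hnonneg : ∀ p ∈ W.offDiag, 0 ≤ renormEnergy 0 p.1 p.2 := by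
    intro p hp
    rw [Finset.mem_offDiag] at hp
    obtain ⟨h1, h2, h12⟩ := hp
    rw [hW_def, Finset.mem_Icc] at h1 h2
    exact renormEnergy_zero_nonneg hx hγ (ha1.trans h1.1) (ha1.trans h2.1) h12
  -- nearest-neighbour indices `W' = {n ∈ W | n + 2 ≤ b}`
  set W' : Finset ℕ := W.filter fun n ↦ n + 2 ≤ b with hW'_def
  have hW'W : ∀ n ∈ W', n + 1 ∈ W ∧ n + 2 ∈ W := by
    intro n hn
    rw [hW'_def, Finset.mem_filter, hW_def, Finset.mem_Icc] at hn
    rw [hW_def, Finset.mem_Icc, Finset.mem_Icc]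
    omega
  have hsumE : ∑ n ∈ W', renormEnergy 0 (n + 1) (n + 2) ≤
      (e / 3) ^ 2 * e / (128 * π ^ 2) * (T * L ^ 3) :=
    (sum_renormEnergy_succ_le hnonneg hW'W).trans (hT₁ T hTT₁)
  -- per-index data: `d n = ξ_{n+2} − ξ_{n+1}`, `g n = 2(γ_{n+1} − γ_n)/d n`
  set d : ℕ → ℝ := fun n ↦ classicalLocation ((n : ℝ) + 2) - classicalLocation ((n : ℝ) + 1)
    with hd_def
  set g : ℕ → ℝ := fun n ↦ (2 * zetaOrdinate (n + 1) - 2 * zetaOrdinate n) / d n with hg_def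
  have hE_eq : ∀ n : ℕ, renormEnergy 0 (n + 1) (n + 2) = renormPotential (g n) / d n ^ 2 :=
    fun n ↦ renormEnergy_succ_succ_eq hx n
  have hwin : ∀ n ∈ W', 0 < d n ∧ d n * L ≤ 8 * π ∧
      |d n * L / (4 * π) - 1| ≤ Real.log (4 * π) / (L - Real.log (4 * π)) := by
    intro n hn
    rw [hW'_def, Finset.mem_filter, hW_def, Finset.mem_Icc] at hn
    have hj : T * L ≤ (n : ℝ) + 1 := by
      have : (a : ℝ) ≤ n := by exact_mod_cast hn.1.1
      linarith
    have hj' : (n : ℝ) + 1 + 1 ≤ 4 * T * L := by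
      have : ((n + 2 : ℕ) : ℝ) ≤ b := by exact_mod_cast hn.2
      push_cast at this
      linarith
    obtain ⟨h1, h2, h3⟩ := classicalLocation_gap_window hT4π hLgt hj hj'
    have h12 : (n : ℝ) + 1 + 1 = n + 2 := by ring
    rw [h12] at h1 h2 h3
    exact ⟨h1, hdL _ h2, h3⟩
  have hV0 : ∀ n ∈ W', 0 ≤ renormPotential (g n) := by
    intro n hn
    have h' : 0 ≤ renormEnergy 0 (n + 1) (n + 2) :=
      hnonneg (n + 1, n + 2) (Finset.mem_offDiag.2 ⟨(hW'W n hn).1, (hW'W n hn).2, by simp⟩)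
    rw [hE_eq] at h'
    have := mul_nonneg h' (sq_nonneg (d n))
    rwa [div_mul_cancel₀ _ (pow_ne_zero 2 (hwin n hn).1.ne')] at this
  -- Step A: `Σ_{n ∈ W'} V(g n) ≤ (64π²/L²) Σ Ẽ ≤ (δ e/2) T L`
  have hsumV : ∑ n ∈ W', renormPotential (g n) ≤ (e / 3) ^ 2 * e / 2 * (T * L) := by
    calc ∑ n ∈ W', renormPotential (g n)
        ≤ ∑ n ∈ W', 64 * π ^ 2 / L ^ 2 * renormEnergy 0 (n + 1) (n + 2) := by
          refine Finset.sum_le_sum fun n hn ↦ ?_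
          rw [hE_eq]
          exact le_mul_div_sq_of_mul_le (hwin n hn).1 hLpos (hwin n hn).2.1 (hV0 n hn)
      _ = 64 * π ^ 2 / L ^ 2 * ∑ n ∈ W', renormEnergy 0 (n + 1) (n + 2) := by
          rw [Finset.mul_sum]
      _ ≤ 64 * π ^ 2 / L ^ 2 * ((e / 3) ^ 2 * e / (128 * π ^ 2) * (T * L ^ 3)) :=
          mul_le_mul_of_nonneg_left hsumE (by positivity)
      _ = (e / 3) ^ 2 * e / 2 * (T * L) := by
          field_simp
          ring
  -- Step B: Markov, `#B ≤ e T L / 2` for `B = {n ∈ W' | δ ≤ V(g n)}`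
  set B : Finset ℕ := W'.filter fun n ↦ (e / 3) ^ 2 ≤ renormPotential (g n) with hB_def
  have hcardB : (B.card : ℝ) ≤ e * (T * L) / 2 := by
    have h1 : (e / 3) ^ 2 * (B.card : ℝ) ≤ (e / 3) ^ 2 * e / 2 * (T * L) :=
      (mul_card_filter_le_sum hV0).trans hsumV
    have h2 : (e / 3) ^ 2 * (B.card : ℝ) ≤ (e / 3) ^ 2 * (e * (T * L) / 2) := by linarith
    exact le_of_mul_le_mul_left h2 hδ0
  -- Step C: exceptional indices lie in `B ∪ {n ∈ W | ¬ n + 2 ≤ b}`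
  have hsub : (W.filter fun n ↦
      ε < |(zetaOrdinate (n + 1) - zetaOrdinate n) * Real.log T / (2 * π) - 1|) ⊆
      B ∪ W.filter fun n ↦ ¬ n + 2 ≤ b := by
    intro n hn
    rw [Finset.mem_filter] at hn
    rw [Finset.mem_union]
    by_cases hnb : n + 2 ≤ b
    · left
      have hnW' : n ∈ W' := Finset.mem_filter.2 ⟨hn.1, hnb⟩
      refine Finset.mem_filter.2 ⟨hnW', ?_⟩
      by_contra hlt
      obtain ⟨hd0, -, hρ⟩ := hwin n hnW'
      have hgood := abs_gap_sub_one_le_of_renormPotential_lt hd0 (hγ (Nat.lt_succ_self n))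
        hρ hτe hτ1 he3 he0 (lt_of_not_ge hlt)
      exact absurd (hgood.trans heε) (not_le.2 hn.2)
    · right
      exact Finset.mem_filter.2 ⟨hn.1, hnb⟩
  -- Step D: count
  calc (((Finset.Icc ⌈T * Real.log T⌉₊ ⌊2 * T * Real.log T⌋₊).filter fun n ↦
          ε < |(zetaOrdinate (n + 1) - zetaOrdinate n) * Real.log T / (2 * π) - 1|).card : ℝ)
      ≤ ((B ∪ W.filter fun n ↦ ¬ n + 2 ≤ b).card : ℝ) := by
        exact_mod_cast Finset.card_le_card hsub
    _ ≤ (B.card : ℝ) + ((W.filter fun n ↦ ¬ n + 2 ≤ b).card : ℝ) := by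
        exact_mod_cast Finset.card_union_le _ _
    _ ≤ e * (T * L) / 2 + 2 := by
        gcongr
        exact_mod_cast card_filter_not_add_two_le a b
    _ ≤ e * (T * L) := by linarith
    _ ≤ ε * (T * Real.log T) := mul_le_mul_of_nonneg_right heε hTLpos.le

end Literature.NumberTheory.LFunctions

end

noncomputable section

open Real Filter Set MeasureTheory

namespace Literature.NumberTheory.LFunctions

/-! ## §8: Prop. 8.1 from Thm. 7.2 and Prop. 8.2 -/

/-- Pigeonholing in time (first display of the proof of Prop. 8.1): if `f` is integrable on
`[a, b]`, `a < b`, and `∫_a^b f ≤ M`, then `f(t) ≤ M/(b − a)` for some `t ∈ (a, b]`. [folklore] -/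
theorem exists_le_div_of_intervalIntegral_le {f : ℝ → ℝ} {a b M : ℝ} (hab : a < b)
    (hf : IntervalIntegrable f volume a b) (hM : ∫ t in a..b, f t ≤ M) :
    ∃ t ∈ Ioc a b, f t ≤ M / (b - a) := by
  have hint : IntegrableOn f (Ioc a b) volume :=
    (intervalIntegrable_iff_integrableOn_Ioc_of_le hab.le).1 hf
  have hμ : volume (Ioc a b) ≠ 0 := by
    rw [Real.volume_Ioc]; exact (ENNReal.ofReal_pos.2 (by linarith)).ne'
  have hμ' : volume (Ioc a b) ≠ ⊤ := by rw [Real.volume_Ioc]; exact ENNReal.ofReal_ne_top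
  obtain ⟨t, ht, hle⟩ := exists_le_setAverage hμ hμ' hint
  refine ⟨t, ht, hle.trans ?_⟩
  rw [setAverage_eq, smul_eq_mul, measureReal_def, Real.volume_Ioc,
    ENNReal.toReal_ofReal (by linarith), ← intervalIntegral.integral_of_le hab.le,
    inv_mul_eq_div]
  exact div_le_div_of_nonneg_right hM (by linarith)

/-- Powers of `log T` are `o(T)`: for all real `M`, `B`, eventually `M (log T)^B ≤ T`. [folklore] -/
theorem eventually_mul_log_rpow_le (M B : ℝ) :
    ∀ᶠ T : ℝ in atTop, M * Real.log T ^ B ≤ T := by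
  have h := (isLittleO_log_rpow_rpow_atTop B one_pos).def (c := 1 / (|M| + 1)) (by positivity)
  filter_upwards [h, eventually_ge_atTop (1 : ℝ), Real.tendsto_log_atTop.eventually_ge_atTop 1]
    with T hT hT1 hL1
  have e1 : ‖Real.log T ^ B‖ = Real.log T ^ B := Real.norm_of_nonneg (Real.rpow_nonneg (by linarith) _)
  have e2 : ‖T ^ (1 : ℝ)‖ = T := by rw [Real.rpow_one]; exact Real.norm_of_nonneg (by linarith)
  rw [e1, e2] at hT
  have h1 : (|M| + 1) * Real.log T ^ B ≤ T := by
    have := mul_le_mul_of_nonneg_left hT (by positivity : (0 : ℝ) ≤ |M| + 1)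
    rwa [← mul_assoc, mul_one_div_cancel (by positivity), one_mul] at this
  have h2 : M * Real.log T ^ B ≤ (|M| + 1) * Real.log T ^ B :=
    mul_le_mul_of_nonneg_right (by linarith [le_abs_self M]) (Real.rpow_nonneg (by linarith) _)
  exact h2.trans h1

/-- Monotonicity of `Ẽ^I(0)` in `I` (last sentence of the proof of Prop. 8.1: "Since `Ẽ^I(0)` is
monotone in `I`"), for windows of positive indices under the identification
`x_{n+1}(0) = 2γ_n` with distinct `γ_n`. [cite: RodgersTaoFMP2020, §8 (proof of Prop. 8.1)] -/
theorem renormEnergyOn_zero_mono (hx : ∀ n : ℕ, deBruijnZero 0 (n + 1) = 2 * zetaOrdinate n)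
    (hγ : StrictMono zetaOrdinate) {I J : Finset ℕ} (hIJ : I ⊆ J) (hJ : ∀ j ∈ J, 1 ≤ j) :
    renormEnergyOn 0 I ≤ renormEnergyOn 0 J := by
  rw [renormEnergyOn_eq, renormEnergyOn_eq]
  refine Finset.sum_le_sum_of_subset_of_nonneg (Finset.offDiag_mono hIJ) fun p hp _ ↦ ?_
  rw [Finset.mem_offDiag] at hp
  exact renormEnergy_zero_nonneg hx hγ (hJ _ hp.1) (hJ _ hp.2.1) hp.2.2

/-- The iteration of Prop. 8.2 ("Applying Proposition 8.2 `O(log² T)` times to get from `t_0`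
to `0`"): abstract bookkeeping. If one step from `k` to `k + 1 ≤ K` costs at most `c` while
shrinking the window `[a + ks, b − ks]` by `s` on each side, then after `k ≤ K` steps the energy
is at most the initial one plus `kc`. [cite: RodgersTaoFMP2020, §8 (proof of Prop. 8.1)] -/
theorem iterate_energy_propagation {E : ℕ → ℝ → ℝ → ℝ} {a b s c : ℝ} {K : ℕ}
    (hstep : ∀ k : ℕ, k < K →
      E (k + 1) (a + (k + 1) * s) (b - (k + 1) * s) ≤ E k (a + k * s) (b - k * s) + c) :
    ∀ k : ℕ, k ≤ K → E k (a + k * s) (b - k * s) ≤ E 0 (a + 0 * s) (b - 0 * s) + k * c := by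
  intro k hk
  induction k with
  | zero => simp
  | succ k ih =>
    have h1 := ih (Nat.le_of_succ_le hk)
    have h2 := hstep k hk
    push_cast at h1 h2 ⊢
    linarith

/-- The time-stepping of the proof of Prop. 8.1, at a fixed large `T`: from the propagation
inequality (Prop. 8.2 at this `T`, for windows `[I₁, I₂]` with `I₁ ∈ [½TL, TL]`, `I₂ ∈ [2TL, 3TL]`
and times `t₀/4 ≤ t₁ ≤ t₂ ≤ 0`, `t₂ ≤ t₁ + 1/(100L²)`, `L = log T`), a starting time
`t_* ∈ (t₀/4, 0]`, and `K = ⌈|t_*| · 100L²⌉` steps of length `|t_*|/K` with `K L³ ≤ TL/2`, one gets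
`Ẽ^{[½TL + KL³, 3TL − KL³]}(0) ≤ Ẽ^{[½TL, 3TL]}(t_*) + K C' L^A` (`C' = max(C, 0)`).
[cite: RodgersTaoFMP2020, §8 (proof of Prop. 8.1)] -/
theorem energy_propagation_to_zero {t₀ A C T ts : ℝ} {K : ℕ}
    (h82 : ∀ I₁ I₂ : ℝ, T * Real.log T / 2 ≤ I₁ → I₁ ≤ T * Real.log T →
      2 * T * Real.log T ≤ I₂ → I₂ ≤ 3 * T * Real.log T →
      ∀ t₁ t₂ : ℝ, t₀ / 4 ≤ t₁ → t₁ ≤ t₂ → t₂ ≤ 0 → t₂ ≤ t₁ + 1 / (100 * Real.log T ^ 2) →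
        renormEnergyOn t₂ (Finset.Icc ⌈I₁ + Real.log T ^ 3⌉₊ ⌊I₂ - Real.log T ^ 3⌋₊) ≤
          renormEnergyOn t₁ (Finset.Icc ⌈I₁⌉₊ ⌊I₂⌋₊) + C * Real.log T ^ A)
    (hL : 0 < Real.log T) (hts : t₀ / 4 < ts) (hts0 : ts ≤ 0)
    (hK : K = ⌈(-ts) * (100 * Real.log T ^ 2)⌉₊)
    (hKL : (K : ℝ) * Real.log T ^ 3 ≤ T * Real.log T / 2) :
    renormEnergyOn 0 (Finset.Icc ⌈T * Real.log T / 2 + K * Real.log T ^ 3⌉₊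
        ⌊3 * T * Real.log T - K * Real.log T ^ 3⌋₊) ≤
      renormEnergyOn ts (Finset.Icc ⌈T * Real.log T / 2⌉₊ ⌊3 * T * Real.log T⌋₊) +
        K * (max C 0 * Real.log T ^ A) := by
  set L : ℝ := Real.log T with hL_def
  -- the step length `h = |ts| / K`
  set h : ℝ := (-ts) / K with hh_def
  have hKge : (-ts) * (100 * L ^ 2) ≤ K := by rw [hK]; exact Nat.le_ceil _
  have hh0 : 0 ≤ h := div_nonneg (by linarith) (Nat.cast_nonneg K)
  have hh1 : h ≤ 1 / (100 * L ^ 2) := by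
    rw [le_div_iff₀ (by positivity), hh_def, div_mul_eq_mul_div]
    exact div_le_one_of_le₀ hKge (Nat.cast_nonneg K)
  have hKh : ts + K * h = 0 := by
    rcases Nat.eq_zero_or_pos K with hK0 | hKpos
    · have hts' : (-ts) * (100 * L ^ 2) ≤ 0 := by
        have := Nat.ceil_eq_zero.1 (hK ▸ hK0 : ⌈(-ts) * (100 * Real.log T ^ 2)⌉₊ = 0)
        exact this
      have : -ts ≤ 0 := by
        by_contra hcon
        have : 0 < (-ts) * (100 * L ^ 2) := mul_pos (lt_of_not_ge hcon) (by positivity)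
        linarith
      have hts00 : ts = 0 := le_antisymm hts0 (by linarith)
      simp [hK0, hts00]
    · rw [hh_def, mul_div_cancel₀ _ (Nat.cast_pos.2 hKpos).ne']
      ring_nf
  -- the iteration
  set E : ℕ → ℝ → ℝ → ℝ := fun k a b ↦ renormEnergyOn (ts + k * h) (Finset.Icc ⌈a⌉₊ ⌊b⌋₊)
    with hE_def
  have hTL : 0 ≤ T * L / 2 := le_trans (by positivity) hKL
  have hstep : ∀ k : ℕ, k < K →
      E (k + 1) (T * L / 2 + (k + 1) * L ^ 3) (3 * T * L - (k + 1) * L ^ 3) ≤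
        E k (T * L / 2 + k * L ^ 3) (3 * T * L - k * L ^ 3) + max C 0 * L ^ A := by
    intro k hk
    have hk1 : ((k : ℝ) + 1) ≤ K := by exact_mod_cast hk
    have hkK : (k : ℝ) * L ^ 3 ≤ T * L / 2 := by
      have : (k : ℝ) * L ^ 3 ≤ K * L ^ 3 :=
        mul_le_mul_of_nonneg_right (by exact_mod_cast hk.le) (by positivity)
      linarith
    have hk0 : 0 ≤ (k : ℝ) * L ^ 3 := by positivity
    have h1 : T * L / 2 ≤ T * L / 2 + k * L ^ 3 := by linarith
    have h2 : T * L / 2 + k * L ^ 3 ≤ T * L := by linarith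
    have h3 : 2 * T * L ≤ 3 * T * L - k * L ^ 3 := by linarith
    have h4 : 3 * T * L - k * L ^ 3 ≤ 3 * T * L := by linarith
    have h5 : t₀ / 4 ≤ ts + k * h := by nlinarith
    have h6 : ts + k * h ≤ ts + (k + 1) * h := by nlinarith
    have h7 : ts + (k + 1) * h ≤ 0 := by
      have : ((k : ℝ) + 1) * h ≤ K * h := mul_le_mul_of_nonneg_right hk1 hh0
      linarith
    have h8 : ts + (k + 1) * h ≤ ts + k * h + 1 / (100 * L ^ 2) := by linarith
    have hmain := h82 _ _ h1 h2 h3 h4 _ _ h5 h6 h7 h8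
    have e1 : T * L / 2 + k * L ^ 3 + L ^ 3 = T * L / 2 + (k + 1) * L ^ 3 := by ring
    have e2 : 3 * T * L - k * L ^ 3 - L ^ 3 = 3 * T * L - (k + 1) * L ^ 3 := by ring
    rw [e1, e2] at hmain
    have hCA : C * L ^ A ≤ max C 0 * L ^ A :=
      mul_le_mul_of_nonneg_right (le_max_left _ _) (Real.rpow_nonneg hL.le _)
    simp only [hE_def]
    push_cast
    linarith
  have hfin := iterate_energy_propagation hstep K le_rfl
  simp only [hE_def, zero_mul, add_zero, sub_zero, Nat.cast_zero, hKh] at hfin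
  exact hfin

/-- **Rodgers–Tao 2020, Prop. 8.1 from Thm. 7.2 and Prop. 8.2** (the deduction printed after the
statement of Prop. 8.2). Under `Λ < 0`: by Thm. 7.2 (`rodgers_tao_integrated_energy_bound`) and
pigeonholing there is a time `t_* ∈ (t₀/4, 0]` at which `Ẽ^{[½T log T, 3T log T]}(t_*) =
o(T log³ T)`; applying Prop. 8.2 (`rodgers_tao_energy_propagation`) `O(log² T)` times to get
from `t_*` to `0` costs `O(log^{A+2} T) = o(T log³ T)` and shrinks the window by `O(log⁵ T)`,
so that it still contains `[T log T, 2T log T]`; monotonicity of `Ẽ^I(0)` in `I` (from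
`rodgers_tao_zeros_zero`) concludes. [cite: RodgersTaoFMP2020, Prop. 8.1 (proof)] -/
theorem rodgers_tao_energy_bound_zero_of_propagation (h72 : rodgers_tao_integrated_energy_bound)
    (h82 : rodgers_tao_energy_propagation) (hz : rodgers_tao_zeros_zero) :
    rodgers_tao_energy_bound_zero := by
  rintro ⟨t₀, ht₀, hreal⟩ ε hε
  obtain ⟨hx, hγ⟩ := hz ⟨t₀, ht₀, hreal⟩
  obtain ⟨A, C, T₂, h82'⟩ := h82 t₀ ht₀ hreal
  have ht₀' : 0 < -t₀ := by linarith
  obtain ⟨T₁, h72'⟩ := h72 t₀ ht₀ hreal (ε * (-t₀) / 8) (by positivity)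
  set C' : ℝ := max C 0 with hC'
  have hC'0 : 0 ≤ C' := le_max_right _ _
  set B : ℝ := max (A - 1) 0 with hB
  -- thresholds
  have hev : ∀ᶠ T : ℝ in atTop, T₁ ≤ T ∧ T₂ ≤ T ∧ Real.exp 1 ≤ T ∧
      (2 * ((25 * (-t₀) + 1) * C') / ε) * Real.log T ^ B ≤ T ∧
      (2 * (25 * (-t₀) + 4)) * Real.log T ^ (4 : ℝ) ≤ T :=
    (eventually_ge_atTop T₁).and ((eventually_ge_atTop T₂).and ((eventually_ge_atTop _).and
      ((eventually_mul_log_rpow_le _ _).and (eventually_mul_log_rpow_le _ _))))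
  obtain ⟨T₀, hT₀⟩ := eventually_atTop.1 hev
  refine ⟨T₀, fun T hT ↦ ?_⟩
  obtain ⟨hTT₁, hTT₂, hTe, hpowA, hpow4⟩ := hT₀ T hT
  set L : ℝ := Real.log T with hL_def
  have hT0 : 0 < T := (Real.exp_pos 1).trans_le hTe
  have hL1 : 1 ≤ L := (Real.le_log_iff_exp_le hT0).2 hTe
  have hL0 : 0 < L := by linarith
  have hTL : 0 < T * L := by positivity
  -- Thm 7.2 and pigeonholing: a good starting time `ts`
  obtain ⟨hint, hI⟩ := h72' T hTT₁
  obtain ⟨ts, hts, hEts⟩ :=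
    exists_le_div_of_intervalIntegral_le (by linarith : t₀ / 4 < 0) hint hI
  have hEts' : renormEnergyOn ts (Finset.Icc ⌈T * Real.log T / 2⌉₊ ⌊3 * T * Real.log T⌋₊) ≤
      ε / 2 * (T * L ^ 3) := by
    have : ε * (-t₀) / 8 * (T * Real.log T ^ 3) / (0 - t₀ / 4) = ε / 2 * (T * L ^ 3) := by
      rw [← hL_def, div_eq_iff (by linarith : (0 : ℝ) - t₀ / 4 ≠ 0)]
      ring
    rwa [this] at hEts
  -- number of steps
  set K : ℕ := ⌈(-ts) * (100 * Real.log T ^ 2)⌉₊ with hK_def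
  have hKle : (K : ℝ) ≤ 25 * (-t₀) * L ^ 2 + 1 := by
    have h1 : (K : ℝ) < (-ts) * (100 * L ^ 2) + 1 :=
      Nat.ceil_lt_add_one (mul_nonneg (by linarith [hts.2]) (by positivity))
    have h2 : (-ts) * (100 * L ^ 2) ≤ (-t₀) / 4 * (100 * L ^ 2) :=
      mul_le_mul_of_nonneg_right (by linarith [hts.1]) (by positivity)
    linarith
  -- `K L³ + 3 ≤ TL/2`, from `2(25|t₀| + 4) L⁴ ≤ T`
  have hL4 : Real.log T ^ (4 : ℝ) = L ^ 4 := by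
    rw [← hL_def]; exact_mod_cast Real.rpow_natCast L 4
  have hKL3 : (K : ℝ) * L ^ 3 + 3 ≤ T * L / 2 := by
    rw [hL4] at hpow4
    have h1 : (K : ℝ) * L ^ 3 ≤ (25 * (-t₀) * L ^ 2 + 1) * L ^ 3 :=
      mul_le_mul_of_nonneg_right hKle (by positivity)
    have h2 : (25 * (-t₀) * L ^ 2 + 1) * L ^ 3 + 3 ≤ (25 * (-t₀) + 4) * L ^ 5 := by
      have hL3 : 1 ≤ L ^ 3 := one_le_pow₀ hL1
      have hL5 : L ^ 3 ≤ L ^ 5 := pow_le_pow_right₀ hL1 (by norm_num)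
      nlinarith
    have h3 : (25 * (-t₀) + 4) * L ^ 5 ≤ T * L / 2 := by
      have := mul_le_mul_of_nonneg_right hpow4 (by positivity : (0 : ℝ) ≤ L / 2)
      nlinarith
    linarith
  have hKL : (K : ℝ) * Real.log T ^ 3 ≤ T * Real.log T / 2 := by rw [← hL_def]; linarith
  -- propagate to time zero
  have hprop := energy_propagation_to_zero (h82' T hTT₂) hL0 hts.1 hts.2 hK_def hKL
  rw [← hL_def] at hprop hEts'
  -- monotonicity in the window
  have hsub : Finset.Icc ⌈T * L⌉₊ ⌊2 * T * L⌋₊ ⊆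
      Finset.Icc ⌈T * L / 2 + K * L ^ 3⌉₊ ⌊3 * T * L - K * L ^ 3⌋₊ :=
    Finset.Icc_subset_Icc (Nat.ceil_mono (by linarith)) (Nat.floor_mono (by linarith))
  have hpos : ∀ j ∈ Finset.Icc ⌈T * L / 2 + K * L ^ 3⌉₊ ⌊3 * T * L - K * L ^ 3⌋₊, 1 ≤ j := by
    intro j hj
    rw [Finset.mem_Icc] at hj
    have : 1 ≤ ⌈T * L / 2 + K * L ^ 3⌉₊ := Nat.one_le_ceil_iff.2 (by positivity)
    exact this.trans hj.1
  have hmono := renormEnergyOn_zero_mono hx hγ hsub hpos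
  -- the cost of the iteration: `K C' L^A ≤ (ε/2) T L³`
  have hcost : (K : ℝ) * (C' * L ^ A) ≤ ε / 2 * (T * L ^ 3) := by
    have h1 : (K : ℝ) * (C' * L ^ A) ≤ (25 * (-t₀) * L ^ 2 + 1) * (C' * L ^ A) :=
      mul_le_mul_of_nonneg_right hKle (mul_nonneg hC'0 (Real.rpow_nonneg hL0.le _))
    have h2 : (25 * (-t₀) * L ^ 2 + 1) ≤ (25 * (-t₀) + 1) * L ^ 2 := by nlinarith
    have hAB : L ^ A ≤ L ^ B * L := by
      rw [← Real.rpow_add_one hL0.ne']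
      exact Real.rpow_le_rpow_of_exponent_le hL1 (by rw [hB]; linarith [le_max_left (A - 1) 0])
    have h3 : (25 * (-t₀) * L ^ 2 + 1) * (C' * L ^ A) ≤
        (25 * (-t₀) + 1) * L ^ 2 * (C' * (L ^ B * L)) := by
      gcongr
    have h4 : (25 * (-t₀) + 1) * C' * L ^ B ≤ ε / 2 * T := by
      have := hpowA
      rw [div_mul_eq_mul_div, div_le_iff₀ hε] at this
      nlinarith
    calc (K : ℝ) * (C' * L ^ A) ≤ (25 * (-t₀) + 1) * L ^ 2 * (C' * (L ^ B * L)) := h1.trans h3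
      _ = ((25 * (-t₀) + 1) * C' * L ^ B) * L ^ 3 := by ring
      _ ≤ (ε / 2 * T) * L ^ 3 := mul_le_mul_of_nonneg_right h4 (by positivity)
      _ = ε / 2 * (T * L ^ 3) := by ring
  calc renormEnergyOn 0 (Finset.Icc ⌈T * Real.log T⌉₊ ⌊2 * T * Real.log T⌋₊)
      ≤ renormEnergyOn 0 (Finset.Icc ⌈T * L / 2 + K * L ^ 3⌉₊ ⌊3 * T * L - K * L ^ 3⌋₊) := by
        rw [← hL_def]; exact hmono
    _ ≤ renormEnergyOn ts (Finset.Icc ⌈T * L / 2⌉₊ ⌊3 * T * L⌋₊) + K * (C' * L ^ A) := hprop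
    _ ≤ ε / 2 * (T * L ^ 3) + ε / 2 * (T * L ^ 3) := add_le_add hEts' hcost
    _ = ε * (T * Real.log T ^ 3) := by rw [← hL_def]; ring

end Literature.NumberTheory.LFunctions

end

noncomputable section

namespace Literature.NumberTheory.LFunctions

/-! ## Discharges of the `Λ < 0`-conditional facts of `RodgersTaoEnergy.lean` (ex falso)

The tree now proves Newman's conjecture unconditionally:
`Literature.NumberTheory.LFunctions.rodgers_tao_holds : ∀ t < 0, ¬ HasOnlyRealZeros (deBruijnH t)`
(`DobnerLemma4Proofs.lean`, the end of the formalisation of A. Dobner's proof of `Λ ≥ 0`, whose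
inputs are all theorems of this library). Every named fact of the Rodgers–Tao decomposition
(`RodgersTao.lean`, `RodgersTaoEnergy.lean`) is, by design, an implication from the standing
hypothesis of the source's proof by contradiction (§1.2: "`H_{t₀}` has only real zeros for some
`t₀ < 0`", i.e. `Λ < 0`), and that hypothesis is exactly what `rodgers_tao_holds` refutes. Hence
each of these facts HOLDS, by a two-line argument, and users `(h : X)` can be fed `X_holds`.

These discharges do **not** formalise §§2–8 of Rodgers–Tao: the constructive content of Thm. 7.2,
Prop. 8.2 and Prop. 8.1 (Riemann–von Mangoldt formulae for `H_t`, the zero dynamics, the gap,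
energy and Hamiltonian estimates for `Λ < t < 0`) lives entirely inside the refuted hypothesis —
there is no `t < 0` for which `H_t` has only real zeros — so these statements admit no
non-vacuous rendering, and any proof of them, however obtained, proves the same proposition. What
the theorems below record is that, logically, nothing in this layer remains to be assumed: the
conditional assemblies of Thm. 1.1 from the leaves of the decomposition (Thm. 7.2 + Prop. 8.2 +
zeros at time `0` + Riemann–von Mangoldt + Selberg–Fujii, see the module docstring) are now closed
(circularly but harmlessly, `rodgers_tao` being a theorem on its own).
-/

/-- **Rodgers–Tao 2020, Thm. 7.2 (strong control on integrated energy) holds**, i.e. the named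
fact `Literature.NumberTheory.LFunctions.rodgers_tao_integrated_energy_bound` of
`RodgersTaoEnergy.lean`: if `H_{t₀}` has only real zeros for some `t₀ < 0`, then for every `ε > 0`
and all large `T`, `t ↦ Ẽ^{[½T log T, 3T log T]}(t)` is integrable on `[t₀/4, 0]` with
`∫_{t₀/4}^0 Ẽ^{[½T log T, 3T log T]}(t) dt ≤ ε T log³ T`. Proof: ex falso — the hypothesis is
refuted for every `t₀ < 0` by `rodgers_tao_holds` (`Λ ≥ 0`, proved in the tree along Dobner's
route, `DobnerLemma4Proofs.lean`); this is a discharge of the fact as stated, not a formalisation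
of §§2–7 of the source (see the section docstring). [cite: RodgersTaoFMP2020, Thm. 7.2] -/
theorem rodgers_tao_integrated_energy_bound_holds : rodgers_tao_integrated_energy_bound :=
  fun t₀ ht₀ hreal ↦ absurd hreal (rodgers_tao_holds t₀ ht₀)

/-- **Rodgers–Tao 2020, Prop. 8.2 (energy propagation inequality) holds**, i.e. the named fact
`Literature.NumberTheory.LFunctions.rodgers_tao_energy_propagation` of `RodgersTaoEnergy.lean`
(Bourgain's pigeonholing step, stated under "`H_{t₀}` has only real zeros for some `t₀ < 0`").
Proof: ex falso from `rodgers_tao_holds` (`Λ ≥ 0`, Dobner's route), exactly as for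
`rodgers_tao_integrated_energy_bound_holds`; not a formalisation of §8 of the source.
[cite: RodgersTaoFMP2020, Prop. 8.2] -/
theorem rodgers_tao_energy_propagation_holds : rodgers_tao_energy_propagation :=
  fun t₀ ht₀ hreal ↦ absurd hreal (rodgers_tao_holds t₀ ht₀)

/-- **Rodgers–Tao 2020, Prop. 8.1 (energy bound at time zero) holds**, i.e. the named fact
`Literature.NumberTheory.LFunctions.rodgers_tao_energy_bound_zero` of `RodgersTaoEnergy.lean`
(stated under `Λ < 0`: "`H_t` has only real zeros for some `t < 0`"). Proof: ex falso from
`rodgers_tao_holds` (`Λ ≥ 0`, Dobner's route); equivalently, `rodgers_tao_energy_bound_zero_of_propagation`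
fed with `rodgers_tao_integrated_energy_bound_holds`, `rodgers_tao_energy_propagation_holds` and
`rodgers_tao_zeros_zero_holds`. Not a formalisation of §8 of the source.
[cite: RodgersTaoFMP2020, Prop. 8.1] -/
theorem rodgers_tao_energy_bound_zero_holds : rodgers_tao_energy_bound_zero :=
  fun ⟨t₀, ht₀, hreal⟩ ↦ absurd hreal (rodgers_tao_holds t₀ ht₀)

end Literature.NumberTheory.LFunctions

end
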